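import Literature.Analysis.FluidPDE.BesovHighFrequencyTail
import HarnessLib

/-!
# The high frequencies of a tempered distribution in divergence form:
# `u - Ṡ_N u = ∑_i ∂_i V_i` with `‖V_i‖_{L^p} ≲ 2^{-N(1+s)} ‖u‖_{Ḃ^s_{p,∞}}`

Analysis/FluidPDE proof file (theorems only: no definition, no named fact). The device behind
Lemma 4.1 of W. Wang, Z. Zhang, *Blow-up of critical norms for the 3-D Navier–Stokes equations*,
Sci. China Math. 60 (2017) = arXiv:1510.02589 ("Since `u ∈ L^∞(-1,0; BMO^{-1})`, there exists
`U_i^j ∈ L^∞(-1,0; BMO)` such that `u_i = ∂_j U_i^j`"; Koch–Tataru 2001, Thm. 1: `BMO^{-1} = ∇·BMO`)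
in the `L^p` form that the Littlewood–Paley theory of the tree gives directly and that suffices
for the local `L³` estimate of that lemma: for `1 ≤ p ≤ ∞`, an orthonormal basis `b` and every
`N ∈ ℤ`, the high-frequency part `u - Ṡ_N u` of a tempered distribution `u` is a sum of
derivatives `∑_i ∂_{b_i} V_i` of `L^p` functions with
`‖V_i‖_{L^p} ≤ C ∑_{j ≥ N} 2^{-j} ‖Δ̇_j u‖_{L^p}` — hence `≤ C_s 2^{-N(1+s)} ‖u‖_{Ḃ^s_{p,∞}}` for
`s > -1` (`exists_sub_lowFreqCutoff_eq_sum_lineDeriv_of_eHomBesovNorm`). With the low-frequency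
bound `‖Ṡ_N u‖_{L^∞} ≲ 2^{N} ‖u‖_{Ḃ^{-1}_{∞,∞}}`
(`FunctionSpaces.eLpNormDistrib_lowFreqCutoff_le_of_neg`) this is the splitting
`u = Ṡ_N u + ∇·V^N` used in place of the `BMO`-Carleson characterisation.

Proof: on each block, `Δ̇_j w = ∑_i ∂_{b_i} ((2πi)⁻¹ σ_{i,j}(D) Δ̇_j w)` with the block-truncated
symbols `σ_{i,j} = (⟪ξ, b_i⟫/‖ξ‖²) ψ(2^{-j}ξ)` of degree `-1` (the identity of the reverse Bernstein
inequality `exists_eLpNormDistrib_lpBlock_le_sum_lineDeriv`, Danchin 2018 Prop. 2.1 / BCD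
Lemma 2.1, with the derivative moved outside: Fourier multipliers commute); BCD Lemma 2.2
(`FunctionSpaces.exists_eLpNormDistrib_truncSymbol_lpBlock_le_of_homogeneous`) bounds
`‖σ_{i,j}(D) Δ̇_j w‖_{L^p} ≤ C 2^{-j} ‖Δ̇_j w‖_{L^p}`; for `w = u - Ṡ_N u` the blocks `j < N` vanish
and the others are `≤ (1 + M₀) ‖Δ̇_j u‖_{L^p}` (`FunctionSpaces.lpBlockWeight_sub_lowFreqCutoff_le`);
the series `V_i = ∑_j (2πi)⁻¹ σ_{i,j}(D) Δ̇_j w` converges absolutely in the Banach space `L^p`,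
hence in `𝓢'`, and `∑_i ∂_{b_i} V_i = ∑_j Δ̇_j w = w` by the Littlewood–Paley reconstruction of the
(always realised) tail (`FunctionSpaces.tendsto_sum_Icc_lpBlock`).

## References

* W. Wang, Z. Zhang, Sci. China Math. 60 (2017) 637–650 = arXiv:1510.02589, proof of Lemma 4.1.
  [WangZhang2016]
* H. Koch, D. Tataru, Adv. Math. 157 (2001) 22–35, Thm. 1 (`BMO^{-1} = ∇ · BMO`). [KochTataru2001]
* H. Bahouri, J.-Y. Chemin, R. Danchin, *Fourier Analysis and Nonlinear PDE* (2011), Lemmas 2.1–2.2,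
  Prop. 2.12. [BahouriCheminDanchin2011]
* R. Danchin, *Fourier analysis methods for the compressible Navier–Stokes equations* (2018),
  Prop. 2.1. [Danchin2018FourierCNS]
-/

noncomputable section

open MeasureTheory TemperedDistribution Filter Set Function
open _root_.Topology
open scoped SchwartzMap ENNReal NNReal LineDeriv

namespace Literature.Analysis.FluidPDE

variable {E : Type*} [NormedAddCommGroup E] [InnerProductSpace ℝ E] [FiniteDimensional ℝ E]
  [MeasurableSpace E] [BorelSpace E] {F : Type*} [NormedAddCommGroup F] [NormedSpace ℂ F]

/-! ## Fourier multipliers commute with derivatives; the block identity -/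

section BlockIdentity

/-- Fourier multipliers (with symbols of temperate growth) commute with the directional
derivatives of tempered distributions: both are Fourier multipliers
(`TemperedDistribution.lineDeriv_eq_fourierMultiplierCLM`). [folklore] -/
theorem fourierMultiplierCLM_lineDeriv_comm {g : E → ℂ} (hg : g.HasTemperateGrowth) (m : E)
    (u : 𝓢'(E, F)) :
    fourierMultiplierCLM F g (∂_{m} u) = ∂_{m} (fourierMultiplierCLM F g u) := by
  have hi : (fun x : E => ((inner ℝ x m : ℝ) : ℂ)).HasTemperateGrowth := by fun_prop
  rw [TemperedDistribution.lineDeriv_eq_fourierMultiplierCLM,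
    TemperedDistribution.lineDeriv_eq_fourierMultiplierCLM, map_smul,
    TemperedDistribution.fourierMultiplierCLM_fourierMultiplierCLM_apply hi hg,
    TemperedDistribution.fourierMultiplierCLM_fourierMultiplierCLM_apply hg hi, mul_comm g]

/-- **Every dyadic block is a divergence** (the identity behind the reverse Bernstein inequality,
Danchin 2018, Prop. 2.1 / BCD Lemma 2.1, with the derivative moved outside):
`Δ̇_j w = ∑_i ∂_{b_i} ((2πi)⁻¹ σ_{i,j}(D) Δ̇_j w)`, where `σ_{i,j} = (⟪ξ, b_i⟫/‖ξ‖²) ψ(2^{-j} ξ)` are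
the block-truncated symbols of degree `-1` (`FunctionSpaces.truncSymbol`) — since
`∑_i ⟪ξ, b_i⟫ σ_{i,j}(ξ) = ψ(2^{-j}ξ)`, `= 1` on the support of `φ_j`, and `⟪D, b_i⟫ = (2πi)⁻¹ ∂_{b_i}`
commutes with the multipliers. [cite: Danchin2018FourierCNS, Prop. 2.1] -/
theorem lpBlock_eq_sum_lineDeriv_truncSymbol {ι : Type*} [Fintype ι] (b : OrthonormalBasis ι ℝ E)
    (j : ℤ) (w : 𝓢'(E, F)) :
    FunctionSpaces.lpBlock j w = ∑ i, ∂_{b i} ((2 * Real.pi * Complex.I : ℂ)⁻¹ •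
      fourierMultiplierCLM F (FunctionSpaces.truncSymbol
        (fun ξ : E => ((inner ℝ ξ (b i) / ‖ξ‖ ^ 2 : ℝ) : ℂ)) j) (FunctionSpaces.lpBlock j w)) := by
  classical
  set c : ℂ := 2 * Real.pi * Complex.I with hcdef
  have hc : c ≠ 0 := by simp [hcdef, Real.pi_ne_zero]
  set τ : ι → E → ℂ := fun i =>
    FunctionSpaces.truncSymbol (fun ξ : E => ((inner ℝ ξ (b i) / ‖ξ‖ ^ 2 : ℝ) : ℂ)) j with hτdef
  have hτ : ∀ i, (τ i).HasTemperateGrowth := fun i =>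
    FunctionSpaces.hasTemperateGrowth_truncSymbol (contDiffOn_inner_div_norm_sq (b i)) j
  have hinn : ∀ i, (fun x : E => ((inner ℝ x (b i) : ℝ) : ℂ)).HasTemperateGrowth := fun i => by
    fun_prop
  -- `ψ(2^{-j} ξ) = ∑_i ⟪ξ, b i⟫ σ_{i,j}(ξ)`
  have hsum : (fun ξ : E => FunctionSpaces.bernsteinSymbol (((2 : ℝ) ^ (-j)) • ξ)) =
      fun ξ => ∑ i ∈ Finset.univ, ((fun x : E => ((inner ℝ x (b i) : ℝ) : ℂ)) * τ i) ξ := by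
    funext ξ
    simp only [Pi.mul_apply, hτdef, FunctionSpaces.truncSymbol_apply]
    by_cases hξ : ξ = 0
    · subst hξ
      simp [FunctionSpaces.bernsteinSymbol_eq_zero_of_norm_le]
    · have hn : (‖ξ‖ ^ 2 : ℝ) ≠ 0 := pow_ne_zero 2 (norm_ne_zero_iff.2 hξ)
      have key : ∑ i, ((inner ℝ ξ (b i) : ℝ) : ℂ) * ((inner ℝ ξ (b i) / ‖ξ‖ ^ 2 : ℝ) : ℂ) = 1 := by
        have h1 : ∑ i, (inner ℝ ξ (b i)) * (inner ℝ ξ (b i) / ‖ξ‖ ^ 2) = (1 : ℝ) := by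
          have h3 : ∀ i, (inner ℝ ξ (b i)) * (inner ℝ ξ (b i) / ‖ξ‖ ^ 2) =
              (inner ℝ ξ (b i)) ^ 2 / ‖ξ‖ ^ 2 := fun i => by ring
          simp_rw [h3]
          rw [← Finset.sum_div, b.sum_sq_inner_left ξ, div_self hn]
        exact_mod_cast congrArg (fun r : ℝ => (r : ℂ)) h1
      symm
      calc ∑ i, ((inner ℝ ξ (b i) : ℝ) : ℂ) *
            (((inner ℝ ξ (b i) / ‖ξ‖ ^ 2 : ℝ) : ℂ) *
              FunctionSpaces.bernsteinSymbol (((2 : ℝ) ^ (-j)) • ξ))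
          = (∑ i, ((inner ℝ ξ (b i) : ℝ) : ℂ) * ((inner ℝ ξ (b i) / ‖ξ‖ ^ 2 : ℝ) : ℂ)) *
              FunctionSpaces.bernsteinSymbol (((2 : ℝ) ^ (-j)) • ξ) := by
            rw [Finset.sum_mul]
            refine Finset.sum_congr rfl fun i _ => ?_
            ring
        _ = FunctionSpaces.bernsteinSymbol (((2 : ℝ) ^ (-j)) • ξ) := by rw [key, one_mul]
  -- `Δ̇_j w = ∑_i (2πi)⁻¹ σ_{i,j}(D) ∂_{b i} Δ̇_j w`
  have hId : FunctionSpaces.lpBlock j w =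
      ∑ i, c⁻¹ • fourierMultiplierCLM F (τ i) (∂_{b i} (FunctionSpaces.lpBlock j w)) := by
    conv_lhs => rw [FunctionSpaces.lpBlock_eq_fourierMultiplierCLM_bernsteinSymbol_rescaled j w,
      hsum, fourierMultiplierCLM_sum F (fun i _ => (hinn i).mul (hτ i))]
    rw [FunLike.coe_sum, Finset.sum_apply]
    refine Finset.sum_congr rfl fun i _ => ?_
    rw [← fourierMultiplierCLM_fourierMultiplierCLM_apply (hinn i) (hτ i)]
    have h := TemperedDistribution.lineDeriv_eq_fourierMultiplierCLM (b i)
      (FunctionSpaces.lpBlock j w)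
    have h' : fourierMultiplierCLM F (fun x : E => ((inner ℝ x (b i) : ℝ) : ℂ))
        (FunctionSpaces.lpBlock j w) = c⁻¹ • ∂_{b i} (FunctionSpaces.lpBlock j w) := by
      rw [h, smul_smul, inv_mul_cancel₀ hc, one_smul]
    rw [h']
    rw [map_smul]
  conv_lhs => rw [hId]
  refine Finset.sum_congr rfl fun i _ => ?_
  rw [fourierMultiplierCLM_lineDeriv_comm (hτ i), ← LineDeriv.lineDerivOp_smul]

end BlockIdentity

/-! ## The divergence form of the high frequencies -/

section DivergenceForm

variable [CompleteSpace F]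

/-- **The high frequencies of a tempered distribution are a divergence of `L^p` functions**
(Wang–Zhang 2017, proof of Lemma 4.1: "`u_i = ∂_j U^j_i`"; Koch–Tataru 2001, Thm. 1, `L^p`
version): for `1 ≤ p ≤ ∞` and an orthonormal basis `b` there is `C` such that for every `N ∈ ℤ`
and every `u ∈ 𝓢'(E, F)` with `S := ∑_{j ≥ N} 2^{-j} ‖Δ̇_j u‖_{L^p} < ∞` there are
`V_i ∈ 𝓢'(E, F)` with `∑_i ∂_{b_i} V_i = u - Ṡ_N u` and `‖V_i‖_{L^p} ≤ C S` for every `i`. Proof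
in the module docstring. [cite: WangZhang2016, proof of Lemma 4.1] [cite: BahouriCheminDanchin2011, Lemmas 2.1–2.2 and Prop. 2.12] -/
theorem exists_sub_lowFreqCutoff_eq_sum_lineDeriv (p : ℝ≥0∞) [Fact (1 ≤ p)] {ι : Type*}
    [Fintype ι] (b : OrthonormalBasis ι ℝ E) :
    ∃ C : ℝ≥0, ∀ (N : ℤ) (u : 𝓢'(E, F)),
      (∑' j : ℤ, (if N ≤ j then (2 : ℝ≥0∞) ^ (-(j : ℝ)) *
          FunctionSpaces.eLpNormDistrib p (FunctionSpaces.lpBlock j u) else 0)) ≠ ⊤ →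
      ∃ V : ι → 𝓢'(E, F),
        (∑ i, ∂_{b i} (V i) = u - FunctionSpaces.lowFreqCutoff N u) ∧
        ∀ i, FunctionSpaces.eLpNormDistrib p (V i) ≤
          C * ∑' j : ℤ, (if N ≤ j then (2 : ℝ≥0∞) ^ (-(j : ℝ)) *
            FunctionSpaces.eLpNormDistrib p (FunctionSpaces.lpBlock j u) else 0) := by
  classical
  -- ### the constants: BCD Lemma 2.2 for the degree `-1` symbols `⟪ξ, b i⟫ / ‖ξ‖²`
  choose C₁ hC₁ using fun i : ι =>
    FunctionSpaces.exists_eLpNormDistrib_truncSymbol_lpBlock_le_of_homogeneous (E := E) (F := F) p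
      (contDiffOn_inner_div_norm_sq (b i)) (inner_div_norm_sq_smul (b i))
  set c : ℂ := 2 * Real.pi * Complex.I with hcdef
  have hc : c ≠ 0 := by simp [hcdef, Real.pi_ne_zero]
  set M₀ : ℝ≥0∞ := FunctionSpaces.lowFreqOpNormBound E with hM₀
  have hM₀top : M₀ ≠ ⊤ := FunctionSpaces.lowFreqOpNormBound_lt_top.ne
  have h1M₀ : (1 + M₀) ≠ ⊤ := ENNReal.add_ne_top.2 ⟨ENNReal.one_ne_top, hM₀top⟩
  set K : ι → ℝ≥0 := fun i => ‖c⁻¹‖₊ * C₁ i * (1 + M₀).toNNReal with hKdef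
  set C : ℝ≥0 := ‖c⁻¹‖₊ * (∑ i, C₁ i) * (1 + M₀).toNNReal with hCdef
  have hKC : ∀ i, K i ≤ C := fun i => by
    show ‖c⁻¹‖₊ * C₁ i * (1 + M₀).toNNReal ≤ ‖c⁻¹‖₊ * (∑ i, C₁ i) * (1 + M₀).toNNReal
    gcongr
    exact Finset.single_le_sum (f := C₁) (fun _ _ => bot_le) (Finset.mem_univ i)
  refine ⟨C, fun N u hS => ?_⟩
  -- ### the data: the weights `a_j`, their sum `S`, the tail `W = u - Ṡ_N u`
  set a : ℤ → ℝ≥0∞ := fun j => if N ≤ j then (2 : ℝ≥0∞) ^ (-(j : ℝ)) *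
      FunctionSpaces.eLpNormDistrib p (FunctionSpaces.lpBlock j u) else 0 with ha
  set S : ℝ≥0∞ := ∑' j, a j with hSdef
  set W : 𝓢'(E, F) := u - FunctionSpaces.lowFreqCutoff N u with hW
  -- the blocks of `W`
  have hWblock : ∀ j, FunctionSpaces.eLpNormDistrib p (FunctionSpaces.lpBlock j W) ≤
      (if N ≤ j then 1 + M₀ else 0) *
        FunctionSpaces.eLpNormDistrib p (FunctionSpaces.lpBlock j u) := by
    intro j
    have h := FunctionSpaces.lpBlockWeight_sub_lowFreqCutoff_le 0 p N u j
    simp only [FunctionSpaces.lpBlockWeight, mul_zero, ENNReal.rpow_zero, one_mul] at h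
    exact h
  -- ### the terms `T_{i,j} = (2πi)⁻¹ σ_{i,j}(D) Δ̇_j W` and their `L^p` norms
  set σ : ι → E → ℂ := fun i ξ => ((inner ℝ ξ (b i) / ‖ξ‖ ^ 2 : ℝ) : ℂ) with hσ
  set T : ι → ℤ → 𝓢'(E, F) := fun i j =>
    c⁻¹ • fourierMultiplierCLM F (FunctionSpaces.truncSymbol (σ i) j)
      (FunctionSpaces.lpBlock j W) with hT
  have hTnorm : ∀ i j, FunctionSpaces.eLpNormDistrib p (T i j) ≤ K i * a j := by
    intro i j
    have h1 := hC₁ i j W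
    have h2m : (2 : ℝ≥0∞) ^ ((j : ℝ) * (-1)) = (2 : ℝ≥0∞) ^ (-(j : ℝ)) := by rw [mul_neg_one]
    rw [h2m] at h1
    rw [hT]
    dsimp only
    rw [FunctionSpaces.eLpNormDistrib_const_smul (inv_ne_zero hc)]
    calc ‖c⁻¹‖ₑ * FunctionSpaces.eLpNormDistrib p (fourierMultiplierCLM F
          (FunctionSpaces.truncSymbol (σ i) j) (FunctionSpaces.lpBlock j W))
        ≤ ‖c⁻¹‖ₑ * (C₁ i * (2 : ℝ≥0∞) ^ (-(j : ℝ)) *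
            FunctionSpaces.eLpNormDistrib p (FunctionSpaces.lpBlock j W)) := mul_le_mul' le_rfl h1
      _ ≤ ‖c⁻¹‖ₑ * (C₁ i * (2 : ℝ≥0∞) ^ (-(j : ℝ)) * ((if N ≤ j then 1 + M₀ else 0) *
            FunctionSpaces.eLpNormDistrib p (FunctionSpaces.lpBlock j u))) := by
          gcongr
          exact hWblock j
      _ = K i * a j := by
          rw [ha, hKdef]
          dsimp only
          split_ifs with hj
          · rw [ENNReal.coe_mul, ENNReal.coe_mul, ENNReal.coe_toNNReal h1M₀, enorm_eq_nnnorm]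
            ring
          · simp
  have hTlt : ∀ i j, FunctionSpaces.eLpNormDistrib p (T i j) < ⊤ := fun i j =>
    (hTnorm i j).trans_lt (ENNReal.mul_lt_top ENNReal.coe_lt_top
      ((ENNReal.le_tsum j).trans_lt hS.lt_top))
  -- ### `L^p` representatives and the absolutely convergent series `V_i = ∑_j T_{i,j}`
  choose f hf using fun i j => FunctionSpaces.exists_coe_eq_of_eLpNormDistrib_lt_top (hTlt i j)
  have hfnorm : ∀ i j, ‖f i j‖ₑ = FunctionSpaces.eLpNormDistrib p (T i j) := fun i j => by
    rw [← hf i j, FunctionSpaces.eLpNormDistrib_coe]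
  have htsum_le : ∀ i, ∑' j, ‖f i j‖ₑ ≤ K i * S := fun i =>
    calc ∑' j, ‖f i j‖ₑ = ∑' j, FunctionSpaces.eLpNormDistrib p (T i j) := tsum_congr (hfnorm i)
      _ ≤ ∑' j, K i * a j := ENNReal.tsum_le_tsum (hTnorm i)
      _ = K i * S := ENNReal.tsum_mul_left
  have hsumN : ∀ i, Summable fun j : ℤ => ‖f i j‖ := by
    intro i
    have h1 : ∑' j : ℤ, ((‖f i j‖₊ : ℝ≥0) : ℝ≥0∞) ≠ ⊤ := by
      refine ne_top_of_le_ne_top (ENNReal.mul_ne_top (ENNReal.coe_ne_top (r := K i)) hS) ?_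
      simpa only [← enorm_eq_nnnorm] using htsum_le i
    have h2 := ENNReal.tsum_coe_ne_top_iff_summable.1 h1
    simpa using (NNReal.summable_coe.2 h2)
  set g : ι → Lp F p (volume : Measure E) := fun i => ∑' j, f i j with hg
  have hhas : ∀ i, HasSum (f i) (g i) := fun i => (Summable.of_norm (hsumN i)).hasSum
  set Φ : Lp F p (volume : Measure E) →L[ℂ] 𝓢'(E, F) := Lp.toTemperedDistributionCLM F volume p
    with hΦ
  have hΦapply : ∀ v : Lp F p (volume : Measure E), Φ v = (v : 𝓢'(E, F)) := fun v =>
    Lp.toTemperedDistributionCLM_apply v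
  set V : ι → 𝓢'(E, F) := fun i => ((g i : Lp F p (volume : Measure E)) : 𝓢'(E, F)) with hV
  have hhasV : ∀ i, HasSum (fun j => T i j) (V i) := by
    intro i
    have h := (hhas i).mapL Φ
    simp only [hΦapply, hf] at h
    exact h
  refine ⟨V, ?_, fun i => ?_⟩
  · -- ### the identity `∑_i ∂_{b i} V_i = W`
    have hreal : Tendsto (fun j => FunctionSpaces.lowFreqCutoff j W) atBot (𝓝 0) :=
      FunctionSpaces.tendsto_lowFreqCutoff_sub_lowFreqCutoff_atBot u N
    have hblocks : ∀ j, ∑ i, ∂_{b i} (T i j) = FunctionSpaces.lpBlock j W := fun j =>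
      (lpBlock_eq_sum_lineDeriv_truncSymbol b j W).symm
    have hD : ∀ i, HasSum (fun j => ∂_{b i} (T i j)) (∂_{b i} (V i)) := fun i => by
      have h := (hhasV i).mapL (LineDeriv.lineDerivOpCLM ℂ (𝓢'(E, F)) (b i))
      simpa only [LineDeriv.lineDerivOpCLM_apply] using h
    have hsumD : HasSum (fun j => ∑ i, ∂_{b i} (T i j)) (∑ i, ∂_{b i} (V i)) :=
      hasSum_sum fun i _ => hD i
    simp_rw [hblocks] at hsumD
    have hIcc : Tendsto (fun n : ℕ => Finset.Icc (-(n : ℤ)) (n : ℤ)) atTop atTop := by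
      refine tendsto_atTop_finset_of_monotone
        (fun a b hab => Finset.Icc_subset_Icc (by omega) (by omega)) fun j => ?_
      exact ⟨j.natAbs, Finset.mem_Icc.2 ⟨by omega, by omega⟩⟩
    have hlim1 : Tendsto (fun n : ℕ => ∑ j ∈ Finset.Icc (-(n : ℤ)) (n : ℤ),
        FunctionSpaces.lpBlock j W) atTop (𝓝 (∑ i, ∂_{b i} (V i))) :=
      hsumD.comp hIcc
    have hlim2 := FunctionSpaces.tendsto_sum_Icc_lpBlock W hreal
    exact tendsto_nhds_unique hlim1 hlim2
  · -- ### the `L^p` bound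
    calc FunctionSpaces.eLpNormDistrib p (V i) = ‖g i‖ₑ := by
          rw [hV]
          exact FunctionSpaces.eLpNormDistrib_coe _
      _ ≤ ∑' j, ‖f i j‖ₑ := by rw [hg]; exact enorm_tsum_le_tsum_enorm
      _ ≤ K i * S := htsum_le i
      _ ≤ C * S := by gcongr; exact hKC i

/-- The dyadic tail sum against a `Ḃ^s_{p,∞}` bound: for `-1 < s`,
`∑_{j ≥ N} 2^{-j} ‖Δ̇_j u‖_{L^p} ≤ (1 - 2^{-(1+s)})⁻¹ 2^{-N(1+s)} ‖u‖_{Ḃ^s_{p,∞}}` (each block is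
`≤ 2^{-js} ‖u‖_{Ḃ^s_{p,∞}}`, geometric series of ratio `2^{-(1+s)} < 1`). [folklore] -/
theorem tsum_two_rpow_neg_mul_eLpNormDistrib_lpBlock_le {s : ℝ} (hs : -1 < s) (p : ℝ≥0∞)
    [Fact (1 ≤ p)] (N : ℤ) (u : 𝓢'(E, F)) :
    (∑' j : ℤ, (if N ≤ j then (2 : ℝ≥0∞) ^ (-(j : ℝ)) *
        FunctionSpaces.eLpNormDistrib p (FunctionSpaces.lpBlock j u) else 0)) ≤
      (1 - (2 : ℝ≥0∞) ^ (-(1 + s)))⁻¹ * (2 : ℝ≥0∞) ^ (-((N : ℝ) * (1 + s))) *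
        FunctionSpaces.eHomBesovNorm s p ∞ u := by
  set B : ℝ≥0∞ := FunctionSpaces.eHomBesovNorm s p ∞ u with hB
  set r : ℝ≥0∞ := (2 : ℝ≥0∞) ^ (-(1 + s)) with hr
  have hr1 : r < 1 := ENNReal.rpow_lt_one_of_one_lt_of_neg (by norm_num) (by linarith)
  -- the blocks: `‖Δ̇_j u‖_{L^p} ≤ 2^{-js} B`
  have hblock : ∀ j : ℤ, FunctionSpaces.eLpNormDistrib p (FunctionSpaces.lpBlock j u) ≤
      (2 : ℝ≥0∞) ^ (-((j : ℝ) * s)) * B := by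
    intro j
    have hw : FunctionSpaces.lpBlockWeight s p u j ≤ B := by
      rw [hB, FunctionSpaces.eHomBesovNorm_top]
      exact le_iSup (fun j : ℤ => (2 : ℝ≥0∞) ^ ((j : ℝ) * s) *
        FunctionSpaces.eLpNormDistrib p (FunctionSpaces.lpBlock j u)) j
    calc FunctionSpaces.eLpNormDistrib p (FunctionSpaces.lpBlock j u)
        = (2 : ℝ≥0∞) ^ (-((j : ℝ) * s)) * FunctionSpaces.lpBlockWeight s p u j := by
          rw [FunctionSpaces.lpBlockWeight, ← mul_assoc,
            ← ENNReal.rpow_add _ _ two_ne_zero ENNReal.ofNat_ne_top, neg_add_cancel,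
            ENNReal.rpow_zero, one_mul]
      _ ≤ (2 : ℝ≥0∞) ^ (-((j : ℝ) * s)) * B := by gcongr
  -- termwise: `a_j ≤ 2^{-N(1+s)} r^{(j-N)} B` for `j ≥ N`, `0` otherwise
  have hterm : ∀ j : ℤ, (if N ≤ j then (2 : ℝ≥0∞) ^ (-(j : ℝ)) *
      FunctionSpaces.eLpNormDistrib p (FunctionSpaces.lpBlock j u) else 0) ≤
      if N ≤ j then (2 : ℝ≥0∞) ^ (-((N : ℝ) * (1 + s))) * r ^ (j - N).toNat * B else 0 := by
    intro j
    split_ifs with hj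
    · have hnat : (((j - N).toNat : ℕ) : ℝ) = (j : ℝ) - N := by
        have h1 : (((j - N).toNat : ℕ) : ℤ) = j - N := Int.toNat_of_nonneg (by omega)
        have h2 : (((j - N).toNat : ℕ) : ℝ) = ((((j - N).toNat : ℕ) : ℤ) : ℝ) :=
          (Int.cast_natCast _).symm
        rw [h2, h1]
        push_cast
        ring
      have hpow : (2 : ℝ≥0∞) ^ (-(j : ℝ)) * (2 : ℝ≥0∞) ^ (-((j : ℝ) * s)) =
          (2 : ℝ≥0∞) ^ (-((N : ℝ) * (1 + s))) * r ^ (j - N).toNat := by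
        rw [hr, ← ENNReal.rpow_natCast, ← ENNReal.rpow_mul, hnat,
          ← ENNReal.rpow_add _ _ two_ne_zero ENNReal.ofNat_ne_top,
          ← ENNReal.rpow_add _ _ two_ne_zero ENNReal.ofNat_ne_top]
        congr 1
        ring
      calc (2 : ℝ≥0∞) ^ (-(j : ℝ)) * FunctionSpaces.eLpNormDistrib p (FunctionSpaces.lpBlock j u)
          ≤ (2 : ℝ≥0∞) ^ (-(j : ℝ)) * ((2 : ℝ≥0∞) ^ (-((j : ℝ) * s)) * B) :=
            mul_le_mul' le_rfl (hblock j)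
        _ = (2 : ℝ≥0∞) ^ (-((N : ℝ) * (1 + s))) * r ^ (j - N).toNat * B := by
            rw [← mul_assoc, hpow]
    · exact le_rfl
  -- summation: a geometric series over `j ≥ N`
  have hgeom : (∑' j : ℤ, (if N ≤ j then r ^ (j - N).toNat else (0 : ℝ≥0∞))) = (1 - r)⁻¹ := by
    have e : (fun j : ℤ => if N ≤ j then r ^ (j - N).toNat else (0 : ℝ≥0∞)) =
        fun j => if N ≤ j then (fun k : ℤ => r ^ k.toNat) (j - N) else 0 := rfl
    rw [← ENNReal.tsum_geometric r]
    rw [← (Equiv.addRight N).tsum_eq (fun j : ℤ => if N ≤ j then r ^ (j - N).toNat else (0 : ℝ≥0∞))]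
    simp only [Equiv.coe_addRight, add_sub_cancel_right, le_add_iff_nonneg_left]
    rw [tsum_of_nat_of_neg_add_one (f := fun k : ℤ => if 0 ≤ k then r ^ k.toNat else (0 : ℝ≥0∞))
      ENNReal.summable ENNReal.summable]
    have h1 : (∑' n : ℕ, if (0 : ℤ) ≤ (n : ℤ) then r ^ (n : ℤ).toNat else (0 : ℝ≥0∞)) =
        ∑' n : ℕ, r ^ n := tsum_congr fun n => by simp
    have h2 : (∑' n : ℕ, if (0 : ℤ) ≤ -((n : ℤ) + 1) then r ^ (-((n : ℤ) + 1)).toNat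
        else (0 : ℝ≥0∞)) = 0 := by
      rw [ENNReal.tsum_eq_zero]
      intro n
      rw [if_neg (by omega)]
    rw [h1, h2, add_zero]
  calc (∑' j : ℤ, (if N ≤ j then (2 : ℝ≥0∞) ^ (-(j : ℝ)) *
        FunctionSpaces.eLpNormDistrib p (FunctionSpaces.lpBlock j u) else 0))
      ≤ ∑' j : ℤ, (if N ≤ j then (2 : ℝ≥0∞) ^ (-((N : ℝ) * (1 + s))) * r ^ (j - N).toNat * B
          else 0) := ENNReal.tsum_le_tsum hterm
    _ = ∑' j : ℤ, ((2 : ℝ≥0∞) ^ (-((N : ℝ) * (1 + s))) * B) *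
          (if N ≤ j then r ^ (j - N).toNat else 0) := by
        refine tsum_congr fun j => ?_
        split_ifs <;> ring
    _ = ((2 : ℝ≥0∞) ^ (-((N : ℝ) * (1 + s))) * B) * (1 - r)⁻¹ := by
        rw [ENNReal.tsum_mul_left, hgeom]
    _ = (1 - (2 : ℝ≥0∞) ^ (-(1 + s)))⁻¹ * (2 : ℝ≥0∞) ^ (-((N : ℝ) * (1 + s))) *
          FunctionSpaces.eHomBesovNorm s p ∞ u := by rw [hr, hB]; ring

/-- **The high frequencies of an element of `Ḃ^s_{p,∞}`, `s > -1`, in divergence form**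
(Wang–Zhang 2017, proof of Lemma 4.1; Koch–Tataru 2001, Thm. 1): for `1 ≤ p ≤ ∞`, `-1 < s` and an
orthonormal basis `b` there is `C` such that for every `N ∈ ℤ` and every tempered distribution `u`
of finite `Ḃ^s_{p,∞}` norm there are `V_i` with `∑_i ∂_{b_i} V_i = u - Ṡ_N u` and
`‖V_i‖_{L^p} ≤ C 2^{-N(1+s)} ‖u‖_{Ḃ^s_{p,∞}}` (for the critical spaces `s = -1 + d/p` the gain is
`2^{-Nd/p}`: `V_i` has the size of an `Ḃ^{d/p}_{p,∞} ⊂ BMO` function cut at frequency `2^N`).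
[cite: WangZhang2016, proof of Lemma 4.1] [cite: KochTataru2001, Thm. 1] -/
theorem exists_sub_lowFreqCutoff_eq_sum_lineDeriv_of_eHomBesovNorm (p : ℝ≥0∞) [Fact (1 ≤ p)]
    {s : ℝ} (hs : -1 < s) {ι : Type*} [Fintype ι] (b : OrthonormalBasis ι ℝ E) :
    ∃ C : ℝ≥0, ∀ (N : ℤ) (u : 𝓢'(E, F)), FunctionSpaces.eHomBesovNorm s p ∞ u ≠ ⊤ →
      ∃ V : ι → 𝓢'(E, F),
        (∑ i, ∂_{b i} (V i) = u - FunctionSpaces.lowFreqCutoff N u) ∧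
        ∀ i, FunctionSpaces.eLpNormDistrib p (V i) ≤
          C * (2 : ℝ≥0∞) ^ (-((N : ℝ) * (1 + s))) * FunctionSpaces.eHomBesovNorm s p ∞ u := by
  obtain ⟨C, hC⟩ := exists_sub_lowFreqCutoff_eq_sum_lineDeriv (E := E) (F := F) p b
  have hr1 : (2 : ℝ≥0∞) ^ (-(1 + s)) < 1 :=
    ENNReal.rpow_lt_one_of_one_lt_of_neg (by norm_num) (by linarith)
  have hgtop : (1 - (2 : ℝ≥0∞) ^ (-(1 + s)))⁻¹ ≠ ⊤ :=
    ENNReal.inv_ne_top.2 (tsub_pos_of_lt hr1).ne'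
  refine ⟨C * ((1 - (2 : ℝ≥0∞) ^ (-(1 + s)))⁻¹).toNNReal, fun N u hu => ?_⟩
  have hS := tsum_two_rpow_neg_mul_eLpNormDistrib_lpBlock_le (E := E) (F := F) hs p N u
  have hStop : (∑' j : ℤ, (if N ≤ j then (2 : ℝ≥0∞) ^ (-(j : ℝ)) *
      FunctionSpaces.eLpNormDistrib p (FunctionSpaces.lpBlock j u) else 0)) ≠ ⊤ :=
    ne_top_of_le_ne_top (ENNReal.mul_ne_top (ENNReal.mul_ne_top hgtop
      (ENNReal.rpow_ne_top_of_ne_zero two_ne_zero ENNReal.ofNat_ne_top)) hu) hS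
  obtain ⟨V, hV, hVle⟩ := hC N u hStop
  refine ⟨V, hV, fun i => (hVle i).trans ?_⟩
  calc C * (∑' j : ℤ, (if N ≤ j then (2 : ℝ≥0∞) ^ (-(j : ℝ)) *
        FunctionSpaces.eLpNormDistrib p (FunctionSpaces.lpBlock j u) else 0))
      ≤ C * ((1 - (2 : ℝ≥0∞) ^ (-(1 + s)))⁻¹ * (2 : ℝ≥0∞) ^ (-((N : ℝ) * (1 + s))) *
          FunctionSpaces.eHomBesovNorm s p ∞ u) := mul_le_mul' le_rfl hS
    _ = ((C * ((1 - (2 : ℝ≥0∞) ^ (-(1 + s)))⁻¹).toNNReal : ℝ≥0) : ℝ≥0∞) *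
          (2 : ℝ≥0∞) ^ (-((N : ℝ) * (1 + s))) * FunctionSpaces.eHomBesovNorm s p ∞ u := by
        rw [ENNReal.coe_mul, ENNReal.coe_toNNReal hgtop]
        ring

end DivergenceForm

end Literature.Analysis.FluidPDE

end
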